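import Literature.AlgebraicGeometry.Resolution.KnafKuhlmann2009Lemma216
import Literature.AlgebraicGeometry.Resolution.KnafKuhlmann2009Lemma21
import Literature.AlgebraicGeometry.Resolution.SeparableClosureValuation
import Literature.AlgebraicGeometry.Resolution.Kuhlmann2019Lemma42NormalForm
import HarnessLib

/-!
# Split immediate extensions have transcendental approximation type

Topic: `Literature/AlgebraicGeometry/Resolution` (valued function fields). PROVED infrastructure
for running the henselian-rationality machinery of F.-V. Kuhlmann, *Elimination of ramification
II: Henselian rationality*, Israel J. Math. 234 (2019) = arXiv:1701.05508, §4–5 (tree files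
`Kuhlmann2019Lemma41.lean`, `Kuhlmann2019Lemma42Center.lean`, `Kuhlmann2019Lemma42NormalForm.lean`,
`KuhlmannVlahuThm111.lean`) over ground fields which are NOT separably closed, as required by
M. Temkin, *Inseparable local uniformization*, J. Algebra 373 (2013) = arXiv:0804.1554, §3.2
(Thm. 3.2.3: one-dimensional `k`-SPLIT analytic fields of type 4 over a deeply ramified `k`;
the valuation-theoretic input of Thm. 3.3.1 = the named fact `Temkin2013RelativeCurveSmoothFibre`).

Those files consume the hypothesis `h3` — "the approximation type of `z` over `K` is
transcendental" (Kuhlmann 2019, §4: "for every polynomial `h(X) ∈ K[X]` there is some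
`α ∈ v(x − K)` such that for all `c ∈ K` with `v(x − c) ≥ α` the value `vh(c)` is fixed";
Knaf–Kuhlmann 2009, Lemma 2.16, condition (3)) — which the tree supplies for separably closed
`K` (`kaplansky_condition_of_isSepClosed`, `KnafKuhlmann2009Lemma216.lean`; Kuhlmann's Lemma 4.6
uses "separable-algebraically maximal"). Here it is derived from SPLITNESS in the sense of
Temkin 2013, §3.1 (p. 22: "`K` is `k`-split if `inf_{c∈k} |T − c| = inf_{c∈k^a} |T − c|` for any
`T ∈ K`"), rendered as in `DeeplyRamifiedSplit.lean`: for `θ, g` algebraic over `K`, if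
`|g| ≤ |z − c|` for all `c ∈ K` then `|g| ≤ |z − θ|`.

## Content (everything PROVED; no definitions, no named facts)

* `eventuallyConst_sub_of_exists_le` — `|a − θ|` is eventually constant near `z` when some
  `c ∈ K` has `|z − c| ≤ |z − θ|`.
* `kaplansky_condition_of_forall_exists_le` — `h3` when every algebraic `θ` admits such a `c`
  (factor over the algebraically closed `Ω`; `eventuallyConst_mul`).
* `forall_exists_valuation_sub_le_of_split` — **for `z` transcendental with `K(z)|K` immediate and
  split at `z`, every algebraic `θ` admits such a `c`** (a transcendentally immediate point lies
  in no disc of its own radius centred at an algebraic point: otherwise `|z − θ| = |h|` with `h`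
  algebraic, the unit `(z − θ)/h` has residue algebraic over `K(z)v = Kv`, equal to the residue of
  an algebraic `η`, and `θ + hη` is an algebraic element STRICTLY closer than `|h|`, against
  splitness).
* `kaplansky_condition_of_split` — the two combined: **`h3` for split immediate transcendental
  `K(z)`**.

## Sources

* M. Temkin, J. Algebra 373 (2013) = arXiv:0804.1554: §3.1 (split fields, Cor. 3.1.10,
  Remark 3.1.11), §3.2 (points of type 4). [Temkin2013]
* F.-V. Kuhlmann, Israel J. Math. 234 (2019) = arXiv:1701.05508: §4 (approximation type),
  Lemmas 4.1, 4.2, 4.6. [Kuhlmann2019]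
* H. Knaf, F.-V. Kuhlmann, Adv. Math. 221 (2009): Lemmas 2.5, 2.16. [KnafKuhlmann2009]

## Rendering notes

As in `KnafKuhlmann2009Lemma216.lean` (`K(z) = Subfield.closure (K ∪ {z})`, transcendence in
polynomial form `htrans`, immediateness `IsImmediateOver`, balls `{a ∈ K : |z − a| ≤ |z − a₀|}`,
multiplicative values) and `DeeplyRamifiedSplit.lean` (splitness tested on elements algebraic
over `K`).
-/

noncomputable section

namespace Literature.AlgebraicGeometry.Resolution

universe u

open Polynomial IsLocalRing

variable {Ω : Type u} [Field Ω] [IsAlgClosed Ω] (V : ValuationSubring Ω) (K : Subfield Ω)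

/-! ### Linear factors with a centre in `K` at least as good -/

omit [IsAlgClosed Ω] in
/-- For `θ ∈ Ω` which is NOT strictly closer to `z` than the whole of `K` — some `c ∈ K` has
`|z − c| ≤ |z − θ|` — the value `|a − θ|` is constant (`= |z − θ|`) for `a ∈ K` close to `z`
(closer than `c`; such `a` exist since the values `|z − a|` have no minimum, Knaf–Kuhlmann 2009,
Lemma 2.5 = `exists_valuation_sub_lt`). [folklore] -/
theorem eventuallyConst_sub_of_exists_le {z : Ω} (hzK : z ∉ K)
    (hval : ∀ w ∈ Subfield.closure ((K : Set Ω) ∪ {z}), w ≠ 0 → ∃ b ∈ K,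
      V.valuation w = V.valuation b)
    (hres : ∀ w ∈ Subfield.closure ((K : Set Ω) ∪ {z}), w ∈ V → ∃ c ∈ K,
      V.valuation (w - c) < 1)
    {θ : Ω} (hθ : ∃ c ∈ K, V.valuation (z - c) ≤ V.valuation (z - θ)) :
    ∃ a₀ ∈ K, ∃ α : V.ValueGroup, ∀ a ∈ K, V.valuation (z - a) ≤ V.valuation (z - a₀) →
      V.valuation ((X - C θ).eval a) = α := by
  obtain ⟨c, hcK, hcθ⟩ := hθ
  obtain ⟨a₀, ha₀, hlt⟩ := exists_valuation_sub_lt V K hzK hval hres hcK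
  refine ⟨a₀, ha₀, V.valuation (z - θ), fun a ha hle => ?_⟩
  rw [eval_sub, eval_X, eval_C]
  have hid : a - θ = (z - θ) - (z - a) := by ring
  rw [hid]
  exact Valuation.map_sub_eq_of_lt_left _ (lt_of_lt_of_le (lt_of_le_of_lt hle hlt) hcθ)

/-- **Kaplansky's condition from "no algebraic element is strictly closer"** (the form of
Knaf–Kuhlmann 2009, Lemma 2.16 / Kuhlmann 2019, Lemma 4.6 "the approximation type of `x` over
`K` is transcendental" needed over NON separably closed ground fields): if `K(z)|K` is immediate
with `z ∉ K` and for every `θ` algebraic over `K` some `c ∈ K` has `|z − c| ≤ |z − θ|`, then for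
every polynomial `g` over `K` the value `|g(a)|` is constant for `a ∈ K` close enough to `z`.
PROVED: factor `g` into linear factors over the algebraically closed `Ω` (roots algebraic over
`K`) and use `eventuallyConst_sub_of_exists_le`, `eventuallyConst_mul`. [folklore] -/
theorem kaplansky_condition_of_forall_exists_le {z : Ω} (hzK : z ∉ K)
    (hval : ∀ w ∈ Subfield.closure ((K : Set Ω) ∪ {z}), w ≠ 0 → ∃ b ∈ K,
      V.valuation w = V.valuation b)
    (hres : ∀ w ∈ Subfield.closure ((K : Set Ω) ∪ {z}), w ∈ V → ∃ c ∈ K,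
      V.valuation (w - c) < 1)
    (hss : ∀ θ : Ω, IsAlgebraic K θ → ∃ c ∈ K, V.valuation (z - c) ≤ V.valuation (z - θ)) :
    ∀ g : Polynomial Ω, (∀ k, g.coeff k ∈ K) → ∃ a₀ ∈ K, ∃ α : V.ValueGroup,
      ∀ a ∈ K, V.valuation (z - a) ≤ V.valuation (z - a₀) → V.valuation (g.eval a) = α := by
  classical
  intro g hg
  by_cases hg0 : g = 0
  · exact ⟨0, K.zero_mem, 0, fun a _ _ => by simp [hg0]⟩
  -- `g` lifts to `K[X]`; its roots in `Ω` are algebraic over `K`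
  obtain ⟨g', hg'⟩ : ∃ g' : Polynomial K, g'.map (algebraMap K Ω) = g :=
    (mem_lifts g).mp (mem_lifts_of_coeff_mem hg)
  have hg'0 : g' ≠ 0 := fun h => hg0 (by rw [← hg', h, Polynomial.map_zero])
  have halg : ∀ θ ∈ g.roots, IsAlgebraic K θ := by
    intro θ hθ
    refine ⟨g', hg'0, ?_⟩
    rw [aeval_def, ← eval_map, hg']
    exact (mem_roots hg0).mp hθ |>.eq_zero
  -- `g = lc · ∏ (X − θ)`
  have hsplit : g.Splits := IsAlgClosed.splits g
  have hprod : ∀ s : Multiset Ω, (∀ θ ∈ s, IsAlgebraic K θ) →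
      ∃ a₀ ∈ K, ∃ α : V.ValueGroup, ∀ a ∈ K, V.valuation (z - a) ≤ V.valuation (z - a₀) →
        V.valuation ((s.map (X - C ·)).prod.eval a) = α := by
    intro s
    induction s using Multiset.induction_on with
    | empty =>
      intro _
      exact ⟨0, K.zero_mem, 1, fun a _ _ => by simp⟩
    | cons θ s ih =>
      intro hs
      rw [Multiset.map_cons, Multiset.prod_cons]
      exact eventuallyConst_mul V K
        (eventuallyConst_sub_of_exists_le V K hzK hval hres (hss θ (hs θ (Multiset.mem_cons_self θ s))))
        (ih fun η hη => hs η (Multiset.mem_cons_of_mem hη))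
  obtain ⟨a₀, ha₀, α, hα⟩ := eventuallyConst_mul V K (eventuallyConst_C V K (z := z) g.leadingCoeff)
    (hprod g.roots halg)
  refine ⟨a₀, ha₀, α, fun a ha hle => ?_⟩
  rw [hsplit.eq_prod_roots]
  exact hα a ha hle

/-! ### Split immediate extensions: no algebraic element is strictly closer -/

/-- **A split immediate transcendental `K(z)` has no algebraic element strictly closer to `z` than
`K`** (Temkin 2013, §3.1–3.2: a point of type 4 — `H(x)/k` transcendentally immediate — lies in
no disc `E(α, r(x))` centred at an algebraic `α` of radius `r(x) = inf_{c ∈ k}|T − c|`; with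
`k`-splitness, `inf_{c∈k} |T − c| = inf_{c∈k^a} |T − c|`, every algebraic `α` is beaten or matched
by an element of `k`). Ambient rendering: `K ≤ Ω` (`Ω` algebraically closed with valuation ring
`V`), `z` transcendental over `K` with `(K(z)|K, V)` immediate, and `K(z)` SPLIT at `z` in the
sense of `DeeplyRamifiedSplit.lean`: for `θ, g` algebraic over `K`, if `|g| ≤ |z − c|` for all
`c ∈ K` then `|g| ≤ |z − θ|`. Then for every `θ` algebraic over `K` some `c ∈ K` has
`|z − c| ≤ |z − θ|`. PROVED: otherwise `|z − θ| < |z − c|` for all `c ∈ K`; the value `|z − θ|`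
is `|h|` for some `h` algebraic over `K` (`vK(z,θ)/vK` is torsion and `vK(z) = vK`), the unit
`u = (z − θ)/h` has residue algebraic over `K(z)v = Kv`, hence equal to the residue of some
`η` algebraic over `K` (`exists_residue_eq_of_isAlgebraic`); then `θ' = θ + hη` is algebraic with
`|z − θ'| < |h| = |z − θ| < |z − c|` for all `c`, contradicting splitness (tested with `g = h`).
[cite: Temkin2013, Cor. 3.1.10 and Section 3.2] -/
theorem forall_exists_valuation_sub_le_of_split {z : Ω}
    (htrans : ∀ P : Polynomial Ω, (∀ k, P.coeff k ∈ K) → P.eval z = 0 → P = 0)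
    (himm : IsImmediateOver V K (Subfield.closure ((K : Set Ω) ∪ {z})))
    (hsplit : ∀ θ g : Ω, IsAlgebraic K θ → IsAlgebraic K g →
      (∀ c ∈ K, V.valuation g ≤ V.valuation (z - c)) → V.valuation g ≤ V.valuation (z - θ))
    {θ : Ω} (hθ : IsAlgebraic K θ) :
    ∃ c ∈ K, V.valuation (z - c) ≤ V.valuation (z - θ) := by
  classical
  set Kz : Subfield Ω := Subfield.closure ((K : Set Ω) ∪ {z}) with hKzdef
  have hKKz : K ≤ Kz := fun c hc => Subfield.subset_closure (Or.inl hc)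
  have hzKz : z ∈ Kz := Subfield.subset_closure (Or.inr rfl)
  have hzK : z ∉ K := not_mem_of_forall_eval_eq_zero K htrans
  have hval : ∀ w ∈ Kz, w ≠ 0 → ∃ b ∈ K, V.valuation w = V.valuation b := himm.1
  have hres : ∀ w ∈ Kz, w ∈ V → ∃ c ∈ K, V.valuation (w - c) < 1 := by
    intro w hw hwV
    have hrw : residue V ⟨w, hwV⟩ ∈ resField V K := himm.2 (residue_mem_resField V ⟨w, hwV⟩ hw)
    obtain ⟨c, hcK, hcw⟩ := (mem_resField_iff V K _).mp hrw
    refine ⟨c, hcK, ?_⟩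
    have h0 : residue V (⟨w, hwV⟩ - c) = 0 := by rw [map_sub, hcw, sub_self]
    exact (ValuationSubring.valuation_lt_one_iff V (⟨w, hwV⟩ - c)).mp ((residue_eq_zero_iff _).mp h0)
  obtain ⟨π, hπK, hπ0, hπ1⟩ := exists_valuation_lt_one_of_immediate V hzK hval hres
  by_contra hcon
  push Not at hcon
  -- `z − θ ≠ 0` (`z` is transcendental)
  have hzalg : ¬ IsAlgebraic K z := by
    rintro ⟨P, hP0, hPz⟩
    apply hP0
    have h := htrans (P.map (algebraMap K Ω)) (fun k => by rw [coeff_map]; exact SetLike.coe_mem _)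
      (by rwa [eval_map, ← aeval_def])
    rw [← Polynomial.map_zero (algebraMap K Ω)] at h
    exact Polynomial.map_injective _ (algebraMap K Ω).injective h
  have hzθ0 : z - θ ≠ 0 := by
    intro h0
    rw [sub_eq_zero] at h0
    exact hzalg (h0 ▸ hθ)
  -- `|z − θ| = |h|` for some `h` algebraic over `K`
  have hθKz : IsAlgebraic Kz θ := isAlgebraic_of_subfield_le hKKz hθ
  have hzθalg : IsAlgebraic Kz (z - θ) :=
    ((isIntegral_algebraMap (x := (⟨z, hzKz⟩ : Kz))).sub hθKz.isIntegral).isAlgebraic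
  obtain ⟨n, hn0, b, hbKz, hb⟩ := exists_valuation_pow_eq_of_isAlgebraic V hzθalg hzθ0
  have hb0 : b ≠ 0 := by
    rintro rfl
    rw [map_zero, map_pow, pow_eq_zero_iff hn0, map_eq_zero] at hb
    exact hzθ0 hb
  obtain ⟨b', hb'K, hbb'⟩ := hval b hbKz hb0
  obtain ⟨h, hh⟩ := IsAlgClosed.exists_pow_nat_eq b' (Nat.pos_of_ne_zero hn0)
  have hhalg : IsAlgebraic K h := by
    refine ⟨X ^ n - C ⟨b', hb'K⟩, ?_, ?_⟩
    · exact (monic_X_pow_sub_C _ hn0).ne_zero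
    · rw [map_sub, map_pow, aeval_X, aeval_C, hh]
      exact sub_self _
  have hvh : V.valuation h = V.valuation (z - θ) := by
    apply pow_left_injective hn0
    change V.valuation h ^ n = V.valuation (z - θ) ^ n
    rw [← map_pow, ← map_pow, hh, ← hbb', hb]
  have hh0 : h ≠ 0 := by
    intro h0
    rw [h0, map_zero, eq_comm, map_eq_zero] at hvh
    exact hzθ0 hvh
  have hvh0 : V.valuation h ≠ 0 := (_root_.map_ne_zero _).mpr hh0
  -- the unit `u = (z − θ)/h` and an algebraic `η` with the same residue
  set u : Ω := (z - θ) / h with hu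
  have hvu : V.valuation u = 1 := by rw [hu, map_div₀, ← hvh, div_self hvh0]
  have huV : u ∈ V := (V.valuation_le_one_iff u).mp hvu.le
  have hhKz : IsAlgebraic Kz h := isAlgebraic_of_subfield_le hKKz hhalg
  have hualg : IsAlgebraic Kz u := by
    rw [hu, div_eq_mul_inv]
    exact (hzθalg.isIntegral.mul hhKz.isIntegral.inv).isAlgebraic
  have hures : IsAlgebraic (resField V K) (residue V ⟨u, huV⟩) := by
    have h1 := isAlgebraic_residue_of_isAlgebraic V huV hualg
    have heq : resField V Kz = resField V K := le_antisymm himm.2 (resField_mono V hKKz)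
    rwa [heq] at h1
  obtain ⟨η, hηsep, hηres⟩ := exists_residue_eq_of_isAlgebraic V K hπK hπ0 hπ1 hures
  have hηalg : IsAlgebraic K (η : Ω) :=
    (mem_separableClosure_iff.mp hηsep).isIntegral.isAlgebraic
  have huη : V.valuation (u - η) < 1 := by
    have h1 := (residue_eq_residue_iff V ⟨u, huV⟩ η).mp hηres.symm
    exact h1
  -- the better algebraic approximation `θ' = θ + hη`
  set θ' : Ω := θ + h * η with hθ'
  have hθ'alg : IsAlgebraic K θ' :=
    (hθ.isIntegral.add (hhalg.isIntegral.mul hηalg.isIntegral)).isAlgebraic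
  have hzθ' : z - θ' = h * (u - η) := by
    rw [hθ', hu]
    field_simp
    ring
  have hlt : V.valuation (z - θ') < V.valuation h := by
    rw [hzθ', map_mul]
    calc V.valuation h * V.valuation (u - η) < V.valuation h * 1 :=
          mul_lt_mul_of_pos_left huη (zero_lt_iff.mpr hvh0)
      _ = V.valuation h := mul_one _
  have hfar : ∀ c ∈ K, V.valuation h ≤ V.valuation (z - c) := fun c hc => by
    rw [hvh]
    exact (hcon c hc).le
  exact absurd (hsplit θ' h hθ'alg hhalg hfar) (not_le.mpr hlt)

/-- **Kaplansky's condition for split immediate transcendental extensions**: `K ≤ Ω`, `z`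
transcendental over `K`, `(K(z)|K, V)` immediate and split at `z` (tested on `θ, g` algebraic over
`K`) ⇒ for every polynomial `g` over `K`, `|g(a)|` is constant for `a ∈ K` close to `z` — the
hypothesis `h3` of `Kuhlmann2019Lemma41.lean`, `Kuhlmann2019Lemma42Center.lean`,
`ImmediateRationalUniformization.lean`, there supplied for separably closed `K` by
`kaplansky_condition_of_isSepClosed`. [folklore] -/
theorem kaplansky_condition_of_split {z : Ω}
    (htrans : ∀ P : Polynomial Ω, (∀ k, P.coeff k ∈ K) → P.eval z = 0 → P = 0)
    (himm : IsImmediateOver V K (Subfield.closure ((K : Set Ω) ∪ {z})))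
    (hsplit : ∀ θ g : Ω, IsAlgebraic K θ → IsAlgebraic K g →
      (∀ c ∈ K, V.valuation g ≤ V.valuation (z - c)) → V.valuation g ≤ V.valuation (z - θ)) :
    ∀ g : Polynomial Ω, (∀ k, g.coeff k ∈ K) → ∃ a₀ ∈ K, ∃ α : V.ValueGroup,
      ∀ a ∈ K, V.valuation (z - a) ≤ V.valuation (z - a₀) → V.valuation (g.eval a) = α := by
  have hzK : z ∉ K := not_mem_of_forall_eval_eq_zero K htrans
  have hval := himm.1
  have hres : ∀ w ∈ Subfield.closure ((K : Set Ω) ∪ {z}), w ∈ V → ∃ c ∈ K,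
      V.valuation (w - c) < 1 := by
    intro w hw hwV
    have hrw : residue V ⟨w, hwV⟩ ∈ resField V K := himm.2 (residue_mem_resField V ⟨w, hwV⟩ hw)
    obtain ⟨c, hcK, hcw⟩ := (mem_resField_iff V K _).mp hrw
    refine ⟨c, hcK, ?_⟩
    have h0 : residue V (⟨w, hwV⟩ - c) = 0 := by rw [map_sub, hcw, sub_self]
    exact (ValuationSubring.valuation_lt_one_iff V (⟨w, hwV⟩ - c)).mp ((residue_eq_zero_iff _).mp h0)
  exact kaplansky_condition_of_forall_exists_le V K hzK hval hres
    fun θ hθ => forall_exists_valuation_sub_le_of_split V K htrans himm hsplit hθ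

end Literature.AlgebraicGeometry.Resolution
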